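import Mathlib
import Summits.Ventures.PercRepro2.Tail2DBlockCalc
import Summits.Ventures.PercRepro2.Tail2DHarrisSP
import Summits.Ventures.PercRepro2.Tail2DFlowOneBlocks
import Summits.Ventures.PercRepro2.Tail2DFlowOneStep01
import Summits.Ventures.PercRepro2.Tail2DParFin
import Summits.Ventures.PercRepro2.Tail2DParFinFlip
import Summits.Ventures.PercRepro2.Tail2DParFinTop
import Summits.Ventures.PercRepro2.Tail2DParFinDiag
import Summits.Ventures.PercRepro2.Tail2DParFinCount
import Summits.Ventures.PercRepro2.Tail2DParFinRelax
import Summits.Ventures.PercRepro2.Tail2DParFinSubTop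
import Summits.Ventures.PercRepro2.Tail2DParFinSubTopB
import Summits.Ventures.PercRepro2.Tail2DParFinFibres
import Summits.Ventures.PercRepro2.Tail2DOneChange
import Summits.Ventures.PercRepro2.Tail2DOneChangeB
import Summits.Ventures.PercRepro2.Tail2DOneChangeC
import Summits.Ventures.PercRepro2.Tail2DFourIdent
import Summits.Ventures.PercRepro2.Tail2DEig40Ident

/-!
# (SD) at `(4,0)` on `8` identical flow-one factors — source-type identities (S2)
(seat mine-b, cell pub-perc-repro2; conjectures/MINE-B.md §44)
-/

namespace Summit.Ventures.PercRepro2.Tail2D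

open V2Closure Finset

namespace IdentEig40

variable {Y : V2Closure.SP}

/-- the source identity at the type `(6,2)` -/
theorem src_6_2 (hR : 0 < (rSet Y).card) (w : Fin 8 → Ltr) (hr : nR 8 w = 6) (hb : nB 8 w = 2) :
    (if ocCom 8 4 0 w then (ratesN Y).ι w else 0)
      + ∑ i ∈ redSet 8 w, ((ratesN Y).f w i
          + (if ocCom 8 4 0 w then (ratesN Y).x w i * (1 + gam 8 (fun _ => Y) i) else 0)) = 1 := by
  have ha : (0 : ℚ) < aY Y := by unfold aY; exact_mod_cast hR
  have hc : (0 : ℚ) ≤ cY Y := by unfold cY; positivity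
  have hD := dN_pos hR
  have hsum : ∀ (φ : ℚ), ∑ i ∈ redSet 8 w, φ = (nR 8 w : ℚ) * φ := by
    intro φ; rw [Finset.sum_const, ← nR_eq_card_redSet, nsmul_eq_mul]
  have hι : ∀ w', (ratesN Y).ι w' = ιN Y (nR 8 w') (nB 8 w') := fun _ => rfl
  have hf : ∀ w' i, (ratesN Y).f w' i = fN Y (nR 8 w') (nB 8 w') := fun _ _ => rfl
  have hx : ∀ w' i, (ratesN Y).x w' i = xN Y (nR 8 w') (nB 8 w') := fun _ _ => rfl
  have hcom : ocCom 8 4 0 w ↔ (4 ≤ nR 8 w ∧ 0 ≤ nB 8 w) ∧ 0 + 1 ≤ nB 8 w := Iff.rfl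
  simp only [gamN, hι, hf, hx, hcom, hr, hb, hsum, ιN, fN, xN]
  norm_num
  try unfold dN
  try field_simp
  try ring


/-- the source identity at the type `(4,3)` -/
theorem src_4_3 (hR : 0 < (rSet Y).card) (w : Fin 8 → Ltr) (hr : nR 8 w = 4) (hb : nB 8 w = 3) :
    (if ocCom 8 4 0 w then (ratesN Y).ι w else 0)
      + ∑ i ∈ redSet 8 w, ((ratesN Y).f w i
          + (if ocCom 8 4 0 w then (ratesN Y).x w i * (1 + gam 8 (fun _ => Y) i) else 0)) = 1 := by
  have ha : (0 : ℚ) < aY Y := by unfold aY; exact_mod_cast hR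
  have hc : (0 : ℚ) ≤ cY Y := by unfold cY; positivity
  have hD := dN_pos hR
  have hsum : ∀ (φ : ℚ), ∑ i ∈ redSet 8 w, φ = (nR 8 w : ℚ) * φ := by
    intro φ; rw [Finset.sum_const, ← nR_eq_card_redSet, nsmul_eq_mul]
  have hι : ∀ w', (ratesN Y).ι w' = ιN Y (nR 8 w') (nB 8 w') := fun _ => rfl
  have hf : ∀ w' i, (ratesN Y).f w' i = fN Y (nR 8 w') (nB 8 w') := fun _ _ => rfl
  have hx : ∀ w' i, (ratesN Y).x w' i = xN Y (nR 8 w') (nB 8 w') := fun _ _ => rfl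
  have hcom : ocCom 8 4 0 w ↔ (4 ≤ nR 8 w ∧ 0 ≤ nB 8 w) ∧ 0 + 1 ≤ nB 8 w := Iff.rfl
  simp only [gamN, hι, hf, hx, hcom, hr, hb, hsum, ιN, fN, xN]
  norm_num
  try unfold dN
  try field_simp
  try ring


/-- the source identity at the type `(5,3)` -/
theorem src_5_3 (hR : 0 < (rSet Y).card) (w : Fin 8 → Ltr) (hr : nR 8 w = 5) (hb : nB 8 w = 3) :
    (if ocCom 8 4 0 w then (ratesN Y).ι w else 0)
      + ∑ i ∈ redSet 8 w, ((ratesN Y).f w i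
          + (if ocCom 8 4 0 w then (ratesN Y).x w i * (1 + gam 8 (fun _ => Y) i) else 0)) = 1 := by
  have ha : (0 : ℚ) < aY Y := by unfold aY; exact_mod_cast hR
  have hc : (0 : ℚ) ≤ cY Y := by unfold cY; positivity
  have hD := dN_pos hR
  have hsum : ∀ (φ : ℚ), ∑ i ∈ redSet 8 w, φ = (nR 8 w : ℚ) * φ := by
    intro φ; rw [Finset.sum_const, ← nR_eq_card_redSet, nsmul_eq_mul]
  have hι : ∀ w', (ratesN Y).ι w' = ιN Y (nR 8 w') (nB 8 w') := fun _ => rfl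
  have hf : ∀ w' i, (ratesN Y).f w' i = fN Y (nR 8 w') (nB 8 w') := fun _ _ => rfl
  have hx : ∀ w' i, (ratesN Y).x w' i = xN Y (nR 8 w') (nB 8 w') := fun _ _ => rfl
  have hcom : ocCom 8 4 0 w ↔ (4 ≤ nR 8 w ∧ 0 ≤ nB 8 w) ∧ 0 + 1 ≤ nB 8 w := Iff.rfl
  simp only [gamN, hι, hf, hx, hcom, hr, hb, hsum, ιN, fN, xN]
  norm_num
  try unfold dN
  try field_simp
  try ring


/-- the source identity at the type `(4,4)` -/
theorem src_4_4 (hR : 0 < (rSet Y).card) (w : Fin 8 → Ltr) (hr : nR 8 w = 4) (hb : nB 8 w = 4) :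
    (if ocCom 8 4 0 w then (ratesN Y).ι w else 0)
      + ∑ i ∈ redSet 8 w, ((ratesN Y).f w i
          + (if ocCom 8 4 0 w then (ratesN Y).x w i * (1 + gam 8 (fun _ => Y) i) else 0)) = 1 := by
  have ha : (0 : ℚ) < aY Y := by unfold aY; exact_mod_cast hR
  have hc : (0 : ℚ) ≤ cY Y := by unfold cY; positivity
  have hD := dN_pos hR
  have hsum : ∀ (φ : ℚ), ∑ i ∈ redSet 8 w, φ = (nR 8 w : ℚ) * φ := by
    intro φ; rw [Finset.sum_const, ← nR_eq_card_redSet, nsmul_eq_mul]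
  have hι : ∀ w', (ratesN Y).ι w' = ιN Y (nR 8 w') (nB 8 w') := fun _ => rfl
  have hf : ∀ w' i, (ratesN Y).f w' i = fN Y (nR 8 w') (nB 8 w') := fun _ _ => rfl
  have hx : ∀ w' i, (ratesN Y).x w' i = xN Y (nR 8 w') (nB 8 w') := fun _ _ => rfl
  have hcom : ocCom 8 4 0 w ↔ (4 ≤ nR 8 w ∧ 0 ≤ nB 8 w) ∧ 0 + 1 ≤ nB 8 w := Iff.rfl
  simp only [gamN, hι, hf, hx, hcom, hr, hb, hsum, ιN, fN, xN]
  norm_num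
  try unfold dN
  try field_simp
  try ring


end IdentEig40

end Summit.Ventures.PercRepro2.Tail2D
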